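import Summits.KontsevichZagierPeriods.KontsevichZagierPeriods.Theorems.HurwitzMicroSectorsNormalFormPrincipleLevelOne
import Summits.KontsevichZagierPeriods.KontsevichZagierPeriods.Theorems.HurwitzMicroSectorsNormalFormPrincipleSlabASubPtK20
import Summits.KontsevichZagierPeriods.KontsevichZagierPeriods.Theorems.HurwitzMicroSectorsNormalFormPrincipleAlgCarriers
import Summits.KontsevichZagierPeriods.KontsevichZagierPeriods.Theorems.HurwitzMicroSectorsNormalFormPrincipleM2FiveZetaTwo
import Summits.KontsevichZagierPeriods.KontsevichZagierPeriods.Theorems.HurwitzMicroSectorsNormalFormPrincipleLevelKExistsReps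

/-!
# `NormalFormPrinciple` (stmt-KontsevichZagierPeriods-3869), line `SketchIdeator1` — leaf `stub_boxRigidity`:
# all weights, level `K`, totally off resonance: the box, band and nested band representations exist

Registered sub-goal `exists_repsN` of the layer `WeightN` (all weights, level `K ≥ 1`, totally off
resonance). For a real algebraic coefficient `c` the three shapes of Kontsevich–Zagier integral
representations of the dimension-generic pipeline exist, with LITERAL domains and integrands; all
integrands are the algebraic constant `c` times a quotient of `ℚ`-polynomials (semialgebraic on ANY
`ℚ`-semialgebraic set once extended by Lean's `x/0 = 0` across the zero set of the denominator,
`wn_isSemialgebraicFunOn_const_mul_aeval_div_aeval`), and absolute convergence is proved as follows: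
* the weight-`w` box `[(0,1)^w, c·(Π_l x_l^{e_l})/(1 − Π_l x_l^K)]` (`w ≥ 2`): domination by
  `|c|/(1 − Π x_l)` (`0 < 1 − Π x_l ≤ 1 − Π x_l^K`, `Π x_l^{e_l} ≤ 1`), the `ζ(w)` box integral
  (`BoxIntegral.integrableOn_box_one_div_one_sub_prod`);
* the band `R_n(A; D) = [{y ∈ (0,1)^n, 0 ≤ t ≤ Π y_i}, c·(Π_{i<n} y_i^{A_i}) t^D/(1 − t^K)]` (`n ≥ 1`,
  the merged box `t = Π x_l`, rule 2): for `n = 1` it is the level-`K` triangle of the weight-two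
  pipeline (`LevelK.lk_integrableOn_triangleIntegrand`); for `n ≥ 2` Tonelli along the fibre
  (`integrableOn_band_of_norm_le`) with the fibrewise bound `|c|/(1 − Π y_i)`
  (`1 − t^K ≥ 1 − t ≥ 1 − Π y_i > 0`), fibre length `Π y_i ≤ 1`, base `|c|/(1 − Π y_i)` integrable;
* the NESTED band over the `R_n`-domain with fibre `t/Π_{i<n} y_i ≤ s ≤ 1` (all `n`; the re-banded
  `R_{n+1}`, rule 2) carrying `c·(Π_{i<n} y_i^{A_i}) s^{A_n} t^D/(1 − t^K)`: Tonelli with the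
  fibrewise bound `|c|/(1 − t^K)` and fibre length `1 − t/Π y_i ≤ 1 − t ≤ 1 − t^K`, so the fibre
  integrals are bounded by the constant `|c|` on the `R_n`-domain `⊆ [0,1]^{n+1}` (for `n = 0` the
  corner `t = s = 1`, where `1 − t^K = 0`, is harmless thanks to `x/0 = 0`).

References: M. Kontsevich, D. Zagier, *Periods* (2001), §1.1–1.2; J. Bochnak, M. Coste, M.-F. Roy,
*Real algebraic geometry* (1998), §2.2. No new definitions.
-/

noncomputable section

open MeasureTheory Set
open Literature.NumberTheory.Transcendental Literature.NumberTheory.Transcendental.KZ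
open Literature.ModelTheory.ExponentialFields (IsSemialgebraic)

namespace Summit.KontsevichZagierPeriods.HurwitzMicroSectors.NormalFormPrinciple.PiBox.WeightN

/-- **An algebraic constant times a quotient of `ℚ`-polynomials is `ℚ`-semialgebraic on any
`ℚ`-semialgebraic set**, with Lean's convention `x/0 = 0` and NO non-vanishing hypothesis on the
denominator: glue the honest quotient on `{q ≠ 0}` (`isSemialgebraicFunOn_aeval_div_aeval`) with
the constant `0` on `{q = 0}`. [cite: BochnakCosteRoy1998, Prop. 2.2.6] -/
theorem wn_isSemialgebraicFunOn_const_mul_aeval_div_aeval {m : ℕ} {s : Set (Fin m → ℝ)}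
    (hs : IsSemialgebraic ℚ s) {c : ℝ} (hc : IsAlgebraic ℚ c) (p q : MvPolynomial (Fin m) ℚ) :
    IsSemialgebraicFunOn ℚ s
      (fun x => c * (MvPolynomial.aeval x p : ℝ) / (MvPolynomial.aeval x q : ℝ)) := by
  have h1 : IsSemialgebraic ℚ (s ∩ {x : Fin m → ℝ | (MvPolynomial.aeval x q : ℝ) ≠ 0}) :=
    hs.inter (Literature.ModelTheory.ExponentialFields.isSemialgebraic_setOf_eval_ne_zero q)
  have h2 : IsSemialgebraic ℚ (s ∩ {x : Fin m → ℝ | (MvPolynomial.aeval x q : ℝ) = 0}) :=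
    hs.inter (Literature.ModelTheory.ExponentialFields.isSemialgebraic_setOf_eval_eq_zero q)
  have hf : IsSemialgebraicFunOn ℚ (s ∩ {x : Fin m → ℝ | (MvPolynomial.aeval x q : ℝ) ≠ 0})
      (fun x => c * (MvPolynomial.aeval x p : ℝ) / (MvPolynomial.aeval x q : ℝ)) :=
    (IsSemialgebraicFunOn.mul_holds (isSemialgebraicFunOn_const_of_isAlgebraic h1 hc)
      (isSemialgebraicFunOn_aeval_div_aeval h1 p q fun x hx => hx.2)).congr fun x _ => by
      simp only [Pi.mul_apply]
      ring
  have hst : s = (s ∩ {x : Fin m → ℝ | (MvPolynomial.aeval x q : ℝ) ≠ 0}) ∪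
      (s ∩ {x : Fin m → ℝ | (MvPolynomial.aeval x q : ℝ) = 0}) := by
    ext x
    simp only [mem_union, mem_inter_iff, mem_setOf_eq]
    tauto
  rw [hst]
  refine hf.union (isSemialgebraicFunOn_ratCast h2 0) (fun x _ => rfl) fun x hx => ?_
  have h0 : (MvPolynomial.aeval x q : ℝ) = 0 := hx.2
  simp [h0]

/-- A product of at least one real number from `(0,1)` lies in `(0,1)`. [folklore] -/
theorem wn_prod_mem_Ioo {n : ℕ} (hn : 0 < n) {y : Fin n → ℝ} (hy : ∀ i, y i ∈ Set.Ioo (0:ℝ) 1) :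
    ∏ i, y i ∈ Set.Ioo (0:ℝ) 1 := by
  obtain ⟨k, rfl⟩ : ∃ k, n = k + 1 := ⟨n - 1, by omega⟩
  refine ⟨Finset.prod_pos fun i _ => (hy i).1, ?_⟩
  rw [Fin.prod_univ_succ]
  exact mul_lt_one_of_nonneg_of_lt_one_left (hy 0).1.le (hy 0).2
    (Finset.prod_le_one (fun i _ => (hy i.succ).1.le) fun i _ => (hy i.succ).2.le)

/-- **Semialgebraicity of the weight-`w` level-`K` box integrand with an algebraic coefficient**:
`x ↦ c·(Π x_l^{e_l})/(1 − Π x_l^K)` is the algebraic constant `c` times a quotient of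
`ℚ`-polynomials. [cite: KontsevichZagier2001, §1.1] -/
theorem wn_isSemialgebraicFunOn_boxIntegrand (w K : ℕ) (e : Fin w → ℕ) {c : ℝ}
    (hc : IsAlgebraic ℚ c) :
    IsSemialgebraicFunOn ℚ {x : Fin w → ℝ | ∀ i, x i ∈ Set.Ioo (0:ℝ) 1}
      (fun x => c * (∏ l, x l ^ (e l)) / (1 - ∏ l, x l ^ K)) :=
  (wn_isSemialgebraicFunOn_const_mul_aeval_div_aeval (isSemialgebraic_box w) hc
    (∏ l, MvPolynomial.X l ^ (e l)) (1 - ∏ l, MvPolynomial.X l ^ K)).congr fun x _ => by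
    simp only [map_prod, map_pow, map_sub, map_one, MvPolynomial.aeval_X]

/-- **Absolute convergence of the weight-`w` level-`K` box integrand** (`w ≥ 2`, `K ≥ 1`, any real
`c`): on the open box `0 < 1 − Π x_l ≤ 1 − Π x_l^K` (as `Π x_l^K = (Π x_l)^K ≤ Π x_l < 1`) and
`0 ≤ Π x_l^{e_l} ≤ 1`, so the integrand is dominated by `|c|/(1 − Π x_l)`, integrable on the open
unit box by the `ζ(w)` box integral (`BoxIntegral.integrableOn_box_one_div_one_sub_prod`).
[cite: KontsevichZagier2001, §1.1] -/
theorem wn_integrableOn_boxIntegrand {w K : ℕ} (hw : 2 ≤ w) (hK : 0 < K) (e : Fin w → ℕ) (c : ℝ) :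
    IntegrableOn (fun x : Fin w → ℝ => c * (∏ l, x l ^ (e l)) / (1 - ∏ l, x l ^ K))
      {x | ∀ i, x i ∈ Set.Ioo (0:ℝ) 1} := by
  refine Integrable.mono' ((BoxIntegral.integrableOn_box_one_div_one_sub_prod hw).const_mul |c|)
    (Measurable.aestronglyMeasurable (by fun_prop))
    (ae_restrict_of_forall_mem (Beukers.measurableSet_cube w) fun x hx => ?_)
  have hp := wn_prod_mem_Ioo (by omega) hx
  have hpow : (∏ l, x l) ^ K ≤ ∏ l, x l := pow_le_of_le_one hp.1.le hp.2.le hK.ne'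
  rw [← Finset.prod_pow] at hpow
  have hD : (0:ℝ) < 1 - ∏ l, x l := sub_pos.2 hp.2
  have hDK : 1 - ∏ l, x l ≤ 1 - ∏ l, x l ^ K := by linarith
  have hM0 : 0 ≤ ∏ l, x l ^ (e l) := Finset.prod_nonneg fun l _ => pow_nonneg (hx l).1.le _
  have hM1 : ∏ l, x l ^ (e l) ≤ 1 := Finset.prod_le_one (fun l _ => pow_nonneg (hx l).1.le _)
    fun l _ => pow_le_one₀ (hx l).1.le (hx l).2.le
  rw [Real.norm_eq_abs, abs_div, abs_mul, abs_of_pos (hD.trans_le hDK), abs_of_nonneg hM0,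
    mul_div_assoc]
  exact mul_le_mul_of_nonneg_left (div_le_div₀ zero_le_one hM1 hD hDK) (abs_nonneg c)

/-- The band `{y ∈ (0,1)^n, 0 ≤ t ≤ Π y_i}` is `ℚ`-semialgebraic (semialgebraic base, polynomial
edges; Tarski–Seidenberg). [cite: KontsevichZagier2001, §1.1] -/
theorem wn_isSemialgebraic_band (n : ℕ) :
    IsSemialgebraic ℚ (KZlog.band {y : Fin n → ℝ | ∀ i, y i ∈ Set.Ioo (0:ℝ) 1} (fun _ => (0:ℝ))
      (fun y => ∏ i, y i)) :=
  KZlog.isSemialgebraic_band (by simpa using isSemialgebraicFunOn_ratCast (isSemialgebraic_box n) 0)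
    ((isSemialgebraicFunOn_aeval (isSemialgebraic_box n) (∏ i, MvPolynomial.X i)).congr
      fun y _ => by simp only [map_prod, MvPolynomial.aeval_X])

/-- On the band `{y ∈ (0,1)^n, 0 ≤ t ≤ Π y_i}` (`n ≥ 1`) the level-`K` denominator (`K ≥ 1`)
dominates `1 − Π y_i`: `0 < 1 − Π y_i ≤ 1 − t^K` (as `t^K ≤ t ≤ Π y_i < 1`), and the monomial
`(Π y_i^{A_i}) t^D` lies in `[0,1]`. [folklore] -/
theorem wn_band_bounds {n K : ℕ} (hn : 0 < n) (hK : 0 < K) (A : Fin n → ℕ) (D : ℕ)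
    {z : Fin (n + 1) → ℝ}
    (hz : z ∈ KZlog.band {y : Fin n → ℝ | ∀ i, y i ∈ Set.Ioo (0:ℝ) 1} (fun _ => (0:ℝ))
      (fun y => ∏ i, y i)) :
    (0 < 1 - ∏ i, z (Fin.castSucc i) ∧ 1 - ∏ i, z (Fin.castSucc i) ≤ 1 - z (Fin.last n) ^ K) ∧
      0 ≤ (∏ i, z (Fin.castSucc i) ^ (A i)) * z (Fin.last n) ^ D ∧
      (∏ i, z (Fin.castSucc i) ^ (A i)) * z (Fin.last n) ^ D ≤ 1 := by
  have h : (∀ i, z (Fin.castSucc i) ∈ Set.Ioo (0:ℝ) 1) ∧ 0 ≤ z (Fin.last n) ∧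
      z (Fin.last n) ≤ ∏ i, z (Fin.castSucc i) := hz
  have hp := wn_prod_mem_Ioo hn h.1
  have ht1 : z (Fin.last n) < 1 := h.2.2.trans_lt hp.2
  have hpow : z (Fin.last n) ^ K ≤ z (Fin.last n) := pow_le_of_le_one h.2.1 ht1.le hK.ne'
  refine ⟨⟨sub_pos.2 hp.2, by linarith [h.2.2]⟩,
    mul_nonneg (Finset.prod_nonneg fun i _ => pow_nonneg (h.1 i).1.le _) (pow_nonneg h.2.1 _),
    mul_le_one₀ (Finset.prod_le_one (fun i _ => pow_nonneg (h.1 i).1.le _)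
      fun i _ => pow_le_one₀ (h.1 i).1.le (h.1 i).2.le) (pow_nonneg h.2.1 _)
      (pow_le_one₀ h.2.1 ht1.le)⟩

/-- **Semialgebraicity of the band integrand with an algebraic coefficient**:
`z ↦ c·(Π_{i<n} z_i^{A_i}) z_n^D/(1 − z_n^K)` is the algebraic constant `c` times a quotient of
`ℚ`-polynomials. [cite: KontsevichZagier2001, §1.1] -/
theorem wn_isSemialgebraicFunOn_bandIntegrand (n K : ℕ) (A : Fin n → ℕ) (D : ℕ) {c : ℝ}
    (hc : IsAlgebraic ℚ c) :
    IsSemialgebraicFunOn ℚ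
      (KZlog.band {y : Fin n → ℝ | ∀ i, y i ∈ Set.Ioo (0:ℝ) 1} (fun _ => (0:ℝ))
        (fun y => ∏ i, y i))
      (fun z => c * (∏ i : Fin n, z (Fin.castSucc i) ^ (A i)) * z (Fin.last n) ^ D /
        (1 - z (Fin.last n) ^ K)) :=
  (wn_isSemialgebraicFunOn_const_mul_aeval_div_aeval (wn_isSemialgebraic_band n) hc
    ((∏ i : Fin n, MvPolynomial.X (Fin.castSucc i) ^ (A i)) * MvPolynomial.X (Fin.last n) ^ D)
    (1 - MvPolynomial.X (Fin.last n) ^ K)).congr fun z _ => by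
    simp only [map_mul, map_prod, map_pow, map_sub, map_one, MvPolynomial.aeval_X]
    ring

/-- **Absolute convergence of the band integrand** (`n ≥ 1`, `K ≥ 1`, any real `c`):
`c·(Π_{i<n} z_i^{A_i}) z_n^D/(1 − z_n^K)` is integrable on `{y ∈ (0,1)^n, 0 ≤ t ≤ Π y_i}`. For
`n = 1` this is the level-`K` triangle (`LevelK.lk_integrableOn_triangleIntegrand`); for `n ≥ 2`
it follows from Tonelli along the fibre (`integrableOn_band_of_norm_le`): fibrewise bound
`|c|/(1 − Π y_i)` (`wn_band_bounds`), fibre length `Π y_i ≤ 1`, and `|c|/(1 − Π y_i)` is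
integrable on `(0,1)^n` (`BoxIntegral.integrableOn_box_one_div_one_sub_prod`).
[cite: KontsevichZagier2001, §1.2 rule (2)] -/
theorem wn_integrableOn_bandIntegrand {n K : ℕ} (hn : 0 < n) (hK : 0 < K) (A : Fin n → ℕ) (D : ℕ)
    (c : ℝ) :
    IntegrableOn (fun z : Fin (n + 1) → ℝ => c * (∏ i : Fin n, z (Fin.castSucc i) ^ (A i)) *
        z (Fin.last n) ^ D / (1 - z (Fin.last n) ^ K))
      (KZlog.band {y : Fin n → ℝ | ∀ i, y i ∈ Set.Ioo (0:ℝ) 1} (fun _ => (0:ℝ))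
        (fun y => ∏ i, y i)) := by
  rcases Nat.lt_or_ge n 2 with h2 | h2
  · -- `n = 1`: the level-`K` triangle of the weight-two pipeline
    obtain rfl : n = 1 := by omega
    have hT := LevelOne.isSemialgebraic_triangleBand
    have e1 : {y : Fin 1 → ℝ | ∀ i, y i ∈ Set.Ioo (0:ℝ) 1} = {y | 0 < y 0 ∧ y 0 < 1} := by
      ext y
      simp [Fin.forall_fin_one]
    have e2 : (fun y : Fin 1 → ℝ => ∏ i, y i) = fun y => y 0 := by
      funext y
      simp
    rw [e1, e2]
    refine (LevelK.lk_integrableOn_triangleIntegrand hK (A 0 + D + 1) D c).congr_fun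
      (fun z _ => ?_) (IsSemialgebraic.measurableSet_holds hT)
    have e3 : A 0 + D + 1 - D - 1 = A 0 := by omega
    show c * (z 0 ^ (A 0 + D + 1 - D - 1) * z 1 ^ D) / (1 - z 1 ^ K) =
      c * (∏ i : Fin 1, z (Fin.castSucc i) ^ (A i)) * z 1 ^ D / (1 - z 1 ^ K)
    rw [e3, Fin.prod_univ_one, Fin.castSucc_zero]
    ring
  · -- `n ≥ 2`: Tonelli along the fibre, base function `|c|/(1 − Π y_i)`
    have hS : MeasurableSet {y : Fin n → ℝ | ∀ i, y i ∈ Set.Ioo (0:ℝ) 1} :=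
      Beukers.measurableSet_cube n
    have hB := IsSemialgebraic.measurableSet_holds (wn_isSemialgebraic_band n)
    have hK1 : IntegrableOn (fun y : Fin n → ℝ => |c| * (1 / (1 - ∏ i, y i)))
        {y | ∀ i, y i ∈ Set.Ioo (0:ℝ) 1} :=
      (BoxIntegral.integrableOn_box_one_div_one_sub_prod h2).const_mul |c|
    refine integrableOn_band_of_norm_le hS (a := fun _ => (0:ℝ)) (b := fun y => ∏ i, y i)
      (M := fun y => |c| / (1 - ∏ i, y i)) (K := fun y => |c| * (1 / (1 - ∏ i, y i)))
      (fun y hy => (wn_prod_mem_Ioo hn hy).1.le) hB (fun y t => KZlog.snoc_mem_band)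
      (Measurable.aestronglyMeasurable (by fun_prop)) (fun y hy t ht => ?_) (fun y hy => ?_) hK1
    · -- the fibrewise bound `|c|/(1 − Π y_i)`
      have hz : (Fin.snoc y t : Fin (n + 1) → ℝ) ∈ KZlog.band
          {y : Fin n → ℝ | ∀ i, y i ∈ Set.Ioo (0:ℝ) 1} (fun _ => (0:ℝ)) (fun y => ∏ i, y i) :=
        KZlog.snoc_mem_band.2 ⟨hy, ht⟩
      have hb := wn_band_bounds hn hK A D hz
      simp only [Fin.snoc_castSucc, Fin.snoc_last] at hb ⊢
      rw [Real.norm_eq_abs, abs_div, mul_assoc, abs_mul, abs_of_pos (hb.1.1.trans_le hb.1.2),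
        abs_of_nonneg hb.2.1, mul_div_assoc]
      exact (mul_le_mul_of_nonneg_left (div_le_div₀ zero_le_one hb.2.2 hb.1.1 hb.1.2)
        (abs_nonneg c)).trans_eq (mul_one_div _ _)
    · -- the fibre has length `Π y_i ≤ 1`
      have hp := wn_prod_mem_Ioo hn hy
      have hM : 0 ≤ |c| / (1 - ∏ i, y i) := div_nonneg (abs_nonneg c) (sub_pos.2 hp.2).le
      rw [sub_zero, mul_one_div]
      exact mul_le_of_le_one_right hM hp.2.le

/-- **The nested band is `ℚ`-semialgebraic**: a band over the (semialgebraic) `R_n`-domain with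
lower edge the quotient of `ℚ`-polynomials `w ↦ w_n/Π_{i<n} w_i` (positive denominator there) and
upper edge the constant `1` (Tarski–Seidenberg). [cite: KontsevichZagier2001, §1.1] -/
theorem wn_isSemialgebraic_nestedBand (n : ℕ) :
    IsSemialgebraic ℚ (KZlog.band
      (KZlog.band {y : Fin n → ℝ | ∀ i, y i ∈ Set.Ioo (0:ℝ) 1} (fun _ => (0:ℝ)) (fun y => ∏ i, y i))
      (fun w => w (Fin.last n) / ∏ i : Fin n, w (Fin.castSucc i)) (fun _ => (1:ℝ))) := by
  have hT := wn_isSemialgebraic_band n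
  refine KZlog.isSemialgebraic_band ?_ (by simpa using isSemialgebraicFunOn_ratCast hT 1)
  refine (isSemialgebraicFunOn_aeval_div_aeval hT (MvPolynomial.X (Fin.last n))
    (∏ i : Fin n, MvPolynomial.X (Fin.castSucc i)) fun w hw => ?_).congr fun w _ => by
    simp only [map_prod, MvPolynomial.aeval_X]
  have h : (∀ i, w (Fin.castSucc i) ∈ Set.Ioo (0:ℝ) 1) ∧ 0 ≤ w (Fin.last n) ∧
      w (Fin.last n) ≤ ∏ i, w (Fin.castSucc i) := hw
  simp only [map_prod, MvPolynomial.aeval_X]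
  exact (Finset.prod_pos fun i _ => (h.1 i).1).ne'

/-- On the nested band the level-`K` denominator `1 − t^K` (`t = z_n`, `K ≥ 1`) is non-negative
and at least `1 − t` (as `0 ≤ t ≤ Π_{i<n} z_i ≤ 1`), and the monomial
`(Π_{i<n} z_i^{A_i}) z_{n+1}^{A_n} z_n^D` lies in `[0,1]` (all coordinates lie in `[0,1]`,
`z_{n+1} ≥ z_n/Π_{i<n} z_i ≥ 0`). [folklore] -/
theorem wn_nested_bounds {n K : ℕ} (hK : 0 < K) (A : Fin (n + 1) → ℕ) (D : ℕ)
    {z : Fin (n + 2) → ℝ}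
    (hz : z ∈ KZlog.band
      (KZlog.band {y : Fin n → ℝ | ∀ i, y i ∈ Set.Ioo (0:ℝ) 1} (fun _ => (0:ℝ)) (fun y => ∏ i, y i))
      (fun w => w (Fin.last n) / ∏ i : Fin n, w (Fin.castSucc i)) (fun _ => (1:ℝ))) :
    (0 ≤ 1 - z (Fin.castSucc (Fin.last n)) ^ K ∧
        1 - z (Fin.castSucc (Fin.last n)) ≤ 1 - z (Fin.castSucc (Fin.last n)) ^ K) ∧
      0 ≤ (∏ i : Fin n, z (Fin.castSucc (Fin.castSucc i)) ^ (A (Fin.castSucc i))) *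
          z (Fin.last (n + 1)) ^ (A (Fin.last n)) * z (Fin.castSucc (Fin.last n)) ^ D ∧
      (∏ i : Fin n, z (Fin.castSucc (Fin.castSucc i)) ^ (A (Fin.castSucc i))) *
          z (Fin.last (n + 1)) ^ (A (Fin.last n)) * z (Fin.castSucc (Fin.last n)) ^ D ≤ 1 := by
  have h : ((∀ i, z (Fin.castSucc (Fin.castSucc i)) ∈ Set.Ioo (0:ℝ) 1) ∧
      0 ≤ z (Fin.castSucc (Fin.last n)) ∧
      z (Fin.castSucc (Fin.last n)) ≤ ∏ i, z (Fin.castSucc (Fin.castSucc i))) ∧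
      z (Fin.castSucc (Fin.last n)) / ∏ i, z (Fin.castSucc (Fin.castSucc i)) ≤
        z (Fin.last (n + 1)) ∧ z (Fin.last (n + 1)) ≤ 1 := hz
  have hP0 : 0 < ∏ i, z (Fin.castSucc (Fin.castSucc i)) :=
    Finset.prod_pos fun i _ => (h.1.1 i).1
  have hP1 : ∏ i, z (Fin.castSucc (Fin.castSucc i)) ≤ 1 :=
    Finset.prod_le_one (fun i _ => (h.1.1 i).1.le) fun i _ => (h.1.1 i).2.le
  have ht0 : 0 ≤ z (Fin.castSucc (Fin.last n)) := h.1.2.1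
  have ht1 : z (Fin.castSucc (Fin.last n)) ≤ 1 := h.1.2.2.trans hP1
  have hs0 : 0 ≤ z (Fin.last (n + 1)) := (div_nonneg ht0 hP0.le).trans h.2.1
  have hKt : z (Fin.castSucc (Fin.last n)) ^ K ≤ z (Fin.castSucc (Fin.last n)) :=
    pow_le_of_le_one ht0 ht1 hK.ne'
  have hQ0 : 0 ≤ ∏ i : Fin n, z (Fin.castSucc (Fin.castSucc i)) ^ (A (Fin.castSucc i)) :=
    Finset.prod_nonneg fun i _ => pow_nonneg (h.1.1 i).1.le _
  have hQ1 : ∏ i : Fin n, z (Fin.castSucc (Fin.castSucc i)) ^ (A (Fin.castSucc i)) ≤ 1 :=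
    Finset.prod_le_one (fun i _ => pow_nonneg (h.1.1 i).1.le _)
      fun i _ => pow_le_one₀ (h.1.1 i).1.le (h.1.1 i).2.le
  exact ⟨⟨sub_nonneg.2 (pow_le_one₀ ht0 ht1), by linarith⟩,
    mul_nonneg (mul_nonneg hQ0 (pow_nonneg hs0 _)) (pow_nonneg ht0 _),
    mul_le_one₀ (mul_le_one₀ hQ1 (pow_nonneg hs0 _) (pow_le_one₀ hs0 h.2.2)) (pow_nonneg ht0 _)
      (pow_le_one₀ ht0 ht1)⟩

/-- **Semialgebraicity of the nested-band integrand with an algebraic coefficient**: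
`z ↦ c·(Π_{i<n} z_i^{A_i}) z_{n+1}^{A_n} z_n^D/(1 − z_n^K)` is the algebraic constant `c` times
a quotient of `ℚ`-polynomials (extended by `0` where `z_n^K = 1`).
[cite: KontsevichZagier2001, §1.1] -/
theorem wn_isSemialgebraicFunOn_nestedIntegrand (n K : ℕ) (A : Fin (n + 1) → ℕ) (D : ℕ) {c : ℝ}
    (hc : IsAlgebraic ℚ c) :
    IsSemialgebraicFunOn ℚ (KZlog.band
      (KZlog.band {y : Fin n → ℝ | ∀ i, y i ∈ Set.Ioo (0:ℝ) 1} (fun _ => (0:ℝ)) (fun y => ∏ i, y i))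
      (fun w => w (Fin.last n) / ∏ i : Fin n, w (Fin.castSucc i)) (fun _ => (1:ℝ)))
      (fun z => c * (∏ i : Fin n, z (Fin.castSucc (Fin.castSucc i)) ^ (A (Fin.castSucc i))) *
          z (Fin.last (n + 1)) ^ (A (Fin.last n)) * z (Fin.castSucc (Fin.last n)) ^ D /
          (1 - z (Fin.castSucc (Fin.last n)) ^ K)) :=
  (wn_isSemialgebraicFunOn_const_mul_aeval_div_aeval (wn_isSemialgebraic_nestedBand n) hc
    ((∏ i : Fin n, MvPolynomial.X (Fin.castSucc (Fin.castSucc i)) ^ (A (Fin.castSucc i))) *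
      MvPolynomial.X (Fin.last (n + 1)) ^ (A (Fin.last n)) *
      MvPolynomial.X (Fin.castSucc (Fin.last n)) ^ D)
    (1 - MvPolynomial.X (Fin.castSucc (Fin.last n)) ^ K)).congr fun z _ => by
    simp only [map_mul, map_prod, map_pow, map_sub, map_one, MvPolynomial.aeval_X]
    ring

/-- **Absolute convergence of the nested-band integrand** (all `n`, `K ≥ 1`, any real `c`), by
Tonelli along the last coordinate (`integrableOn_band_of_norm_le`): over a point `(y, t)` of the
`R_n`-domain the fibre `[t/Π y_i, 1]` has length `1 − t/Π y_i ≤ 1 − t ≤ 1 − t^K` and the integrand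
is bounded there by `|c|/(1 − t^K)` (`wn_nested_bounds`), so the fibre integrals are bounded by
the constant `|c|`, integrable on the `R_n`-domain `⊆ [0,1]^{n+1}`.
[cite: KontsevichZagier2001, §1.2 rule (2)] -/
theorem wn_integrableOn_nestedIntegrand {K : ℕ} (hK : 0 < K) (n : ℕ) (A : Fin (n + 1) → ℕ) (D : ℕ)
    (c : ℝ) :
    IntegrableOn (fun z : Fin (n + 2) → ℝ =>
        c * (∏ i : Fin n, z (Fin.castSucc (Fin.castSucc i)) ^ (A (Fin.castSucc i))) *
          z (Fin.last (n + 1)) ^ (A (Fin.last n)) * z (Fin.castSucc (Fin.last n)) ^ D /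
          (1 - z (Fin.castSucc (Fin.last n)) ^ K))
      (KZlog.band
        (KZlog.band {y : Fin n → ℝ | ∀ i, y i ∈ Set.Ioo (0:ℝ) 1} (fun _ => (0:ℝ))
          (fun y => ∏ i, y i))
        (fun w => w (Fin.last n) / ∏ i : Fin n, w (Fin.castSucc i)) (fun _ => (1:ℝ))) := by
  have hTm := IsSemialgebraic.measurableSet_holds (wn_isSemialgebraic_band n)
  have hNm := IsSemialgebraic.measurableSet_holds (wn_isSemialgebraic_nestedBand n)
  -- unpacking membership in the `R_n`-domain
  have mem : ∀ w : Fin (n + 1) → ℝ, w ∈ KZlog.band {y : Fin n → ℝ | ∀ i, y i ∈ Set.Ioo (0:ℝ) 1}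
      (fun _ => (0:ℝ)) (fun y => ∏ i, y i) → (∀ i, w (Fin.castSucc i) ∈ Set.Ioo (0:ℝ) 1) ∧
        0 ≤ w (Fin.last n) ∧ w (Fin.last n) ≤ ∏ i, w (Fin.castSucc i) := fun w hw => hw
  have hfin : volume (KZlog.band {y : Fin n → ℝ | ∀ i, y i ∈ Set.Ioo (0:ℝ) 1} (fun _ => (0:ℝ))
      (fun y => ∏ i, y i)) ≠ ⊤ := by
    refine ((measure_mono fun w hw => ?_).trans_lt
      (measure_Icc_lt_top (a := (0 : Fin (n + 1) → ℝ)) (b := 1))).ne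
    have h := mem w hw
    have hP1 : ∏ i, w (Fin.castSucc i) ≤ 1 :=
      Finset.prod_le_one (fun i _ => (h.1 i).1.le) fun i _ => (h.1 i).2.le
    rw [Set.mem_Icc, Pi.le_def, Pi.le_def]
    exact ⟨fun i => Fin.lastCases h.2.1 (fun j => (h.1 j).1.le) i,
      fun i => Fin.lastCases (h.2.2.trans hP1) (fun j => (h.1 j).2.le) i⟩
  refine integrableOn_band_of_norm_le hTm
    (a := fun w => w (Fin.last n) / ∏ i : Fin n, w (Fin.castSucc i)) (b := fun _ => (1:ℝ))
    (M := fun w => |c| / (1 - w (Fin.last n) ^ K)) (K := fun _ => |c|)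
    (fun w hw => (div_le_one (Finset.prod_pos fun i _ => ((mem w hw).1 i).1)).2 (mem w hw).2.2)
    hNm (fun w s => KZlog.snoc_mem_band) (Measurable.aestronglyMeasurable (by fun_prop))
    (fun w hw s hs => ?_) (fun w hw => ?_) (integrableOn_const hfin)
  · -- the fibrewise bound `|c|/(1 − t^K)`
    have hb := wn_nested_bounds hK A D (KZlog.snoc_mem_band.2 ⟨hw, hs⟩ :
      (Fin.snoc w s : Fin (n + 2) → ℝ) ∈ KZlog.band
        (KZlog.band {y : Fin n → ℝ | ∀ i, y i ∈ Set.Ioo (0:ℝ) 1} (fun _ => (0:ℝ))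
          (fun y => ∏ i, y i))
        (fun w => w (Fin.last n) / ∏ i : Fin n, w (Fin.castSucc i)) (fun _ => (1:ℝ)))
    simp only [Fin.snoc_castSucc, Fin.snoc_last] at hb ⊢
    have e : c * (∏ i : Fin n, w (Fin.castSucc i) ^ (A (Fin.castSucc i))) *
        s ^ (A (Fin.last n)) * w (Fin.last n) ^ D =
        c * ((∏ i : Fin n, w (Fin.castSucc i) ^ (A (Fin.castSucc i))) *
          s ^ (A (Fin.last n)) * w (Fin.last n) ^ D) := by ring
    rw [e, Real.norm_eq_abs, abs_div, abs_mul, abs_of_nonneg hb.1.1, abs_of_nonneg hb.2.1]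
    exact div_le_div_of_nonneg_right (mul_le_of_le_one_right (abs_nonneg c) hb.2.2) hb.1.1
  · -- the fibre has length `1 − t/Π y_i ≤ 1 − t ≤ 1 − t^K`
    have h := mem w hw
    have hP0 : 0 < ∏ i, w (Fin.castSucc i) := Finset.prod_pos fun i _ => (h.1 i).1
    have hP1 : ∏ i, w (Fin.castSucc i) ≤ 1 :=
      Finset.prod_le_one (fun i _ => (h.1 i).1.le) fun i _ => (h.1 i).2.le
    have ht1 : w (Fin.last n) ≤ 1 := h.2.2.trans hP1
    have hKt : w (Fin.last n) ^ K ≤ w (Fin.last n) := pow_le_of_le_one h.2.1 ht1 hK.ne'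
    have hle : 1 - w (Fin.last n) / ∏ i, w (Fin.castSucc i) ≤ 1 - w (Fin.last n) ^ K := by
      have h1 : w (Fin.last n) ≤ w (Fin.last n) / ∏ i, w (Fin.castSucc i) :=
        le_div_self h.2.1 hP0 hP1
      linarith
    rcases (sub_nonneg.2 (pow_le_one₀ h.2.1 ht1) : (0:ℝ) ≤ 1 - w (Fin.last n) ^ K).eq_or_lt
      with hD | hD
    · rw [← hD, div_zero, zero_mul]
      exact abs_nonneg c
    · calc |c| / (1 - w (Fin.last n) ^ K) * (1 - w (Fin.last n) / ∏ i, w (Fin.castSucc i))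
          ≤ |c| / (1 - w (Fin.last n) ^ K) * (1 - w (Fin.last n) ^ K) :=
            mul_le_mul_of_nonneg_left hle (div_nonneg (abs_nonneg c) hD.le)
        _ = |c| := div_mul_cancel₀ _ hD.ne'

/-- **Stub N6 (existence, all dimensions; registered sub-goal `exists_repsN` of
stmt-KontsevichZagierPeriods-3869).** For `K ≥ 1` and a real algebraic coefficient `c`: (1) the
weight-`w` level-`K` box `[(0,1)^w, c·(Π_l x_l^{e_l})/(1 − Π_l x_l^K)]` (`w ≥ 2`), (2) the band
`R_n(A; D) = [{y ∈ (0,1)^n, 0 ≤ t ≤ Π y_i}, c·(Π_{i<n} y_i^{A_i}) t^D/(1 − t^K)]` (`n ≥ 1`, the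
merged box, rule 2) and (3) the nested band over the `R_n`-domain with fibre
`t/Π_{i<n} y_i ≤ s ≤ 1` carrying `c·(Π_{i<n} y_i^{A_i}) s^{A_n} t^D/(1 − t^K)` (all `n`, the
re-banded `R_{n+1}`, rule 2) exist as integral representations of the Kontsevich–Zagier calculus,
with literally these domains and integrands. [cite: KontsevichZagier2001, §1.2] -/
theorem exists_repsN (K : ℕ) (hK : 0 < K) (c : ℝ) (hc : IsAlgebraic ℚ c) :
    (∀ (w : ℕ) (e : Fin w → ℕ), 2 ≤ w → ∃ N : IntegralRep w,
      N.domain = {x | ∀ i, x i ∈ Set.Ioo (0:ℝ) 1} ∧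
      N.integrand = fun x => c * (∏ l, x l ^ (e l)) / (1 - ∏ l, x l ^ K)) ∧
    (∀ (n : ℕ) (A : Fin n → ℕ) (D : ℕ), 0 < n → ∃ R : IntegralRep (n + 1),
      R.domain = KZlog.band {y : Fin n → ℝ | ∀ i, y i ∈ Set.Ioo (0:ℝ) 1} (fun _ => (0:ℝ))
        (fun y => ∏ i, y i) ∧
      R.integrand = fun z => c * (∏ i : Fin n, z (Fin.castSucc i) ^ (A i)) * z (Fin.last n) ^ D /
        (1 - z (Fin.last n) ^ K)) ∧
    (∀ (n : ℕ) (A : Fin (n + 1) → ℕ) (D : ℕ), ∃ R' : IntegralRep (n + 2),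
      R'.domain = KZlog.band
        (KZlog.band {y : Fin n → ℝ | ∀ i, y i ∈ Set.Ioo (0:ℝ) 1} (fun _ => (0:ℝ)) (fun y => ∏ i, y i))
        (fun w => w (Fin.last n) / ∏ i : Fin n, w (Fin.castSucc i)) (fun _ => (1:ℝ)) ∧
      R'.integrand = fun z =>
        c * (∏ i : Fin n, z (Fin.castSucc (Fin.castSucc i)) ^ (A (Fin.castSucc i))) *
          z (Fin.last (n + 1)) ^ (A (Fin.last n)) * z (Fin.castSucc (Fin.last n)) ^ D /
          (1 - z (Fin.castSucc (Fin.last n)) ^ K)) := by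
  refine ⟨fun w e hw => ?_, fun n A D hn => ?_, fun n A D => ?_⟩
  · exact ⟨⟨_, _, isSemialgebraic_box w, wn_isSemialgebraicFunOn_boxIntegrand w K e hc,
      wn_integrableOn_boxIntegrand hw hK e c⟩, rfl, rfl⟩
  · exact ⟨⟨_, _, wn_isSemialgebraic_band n, wn_isSemialgebraicFunOn_bandIntegrand n K A D hc,
      wn_integrableOn_bandIntegrand hn hK A D c⟩, rfl, rfl⟩
  · exact ⟨⟨_, _, wn_isSemialgebraic_nestedBand n, wn_isSemialgebraicFunOn_nestedIntegrand n K A D hc,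
      wn_integrableOn_nestedIntegrand hK n A D c⟩, rfl, rfl⟩

end Summit.KontsevichZagierPeriods.HurwitzMicroSectors.NormalFormPrinciple.PiBox.WeightN
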